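import Mathlib
import Summits.Ventures.HodgeRepro2.Tier7.Line3.DiscreteCompactFactor

/-!
# Tier 7 — LINE 3 support: `U(2)` is compact — the archimedean model group `U(2) × SL(2,ℝ)²`
(`Line3/DiscreteUnitaryFactor.lean`; t7-L1-p1, gen 3; Mathlib + Line3/DiscreteCompactFactor)

`DiscreteCompactFactor` treats a discrete subgroup of `K × SL(2,ℝ)²` for an abstract compact group `K`; the line's compact
place is `U(W_A)(F_{ι₁}) ≅ U(2)` (memo §0). Mathlib has no `CompactSpace` instance for `Matrix.unitaryGroup (Fin 2) ℂ`; THIS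
FILE proves it (`compactSpace_unitaryGroup`: the unitary matrices are a closed subset — `star A * A = 1`, `A * star A = 1` —
of the compact box of entries of norm `≤ 1`, since the columns of a unitary matrix are unit vectors: `norm_entry_le_one`),
and instantiates the count and the Poincaré-series continuity of `DiscreteCompactFactor` on the archimedean model group
`U(2) × SL(2,ℝ) × SL(2,ℝ)` (`count_U2_product`, `continuous_kernelSum_U2_product_three`; §3: the same with the two centres
`U(1)` of the `(1,1)`-places joined to the compact factor, `K₃ = U(2) × U(1) × U(1)`, `continuous_kernelSum_K₃_product_three`,
`count_K₃_product` — the shape of the lifted real lattice): for every subgroup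
`Γ ≤ U(2) × SL(2,ℝ)²` with `1` isolated, `f₁` bounded continuous on `U(2)`, `f₂, f₃` continuous on `SL(2,ℝ)` with the decay
`(1 + κ)^(−α)`, `α > 1`, the Poincaré series `Σ_{γ ∈ Γ} f₁ f₂ f₃ (x⁻¹ γ y)` is continuous on `(U(2) × SL(2,ℝ)²)²`.
What stays in words: `U(1,1) = U(1)·SU(1,1) ≅ U(1)·SL(2,ℝ)` at `ι₂, ι₃` (x1's U1 + p1's `cay`), the real lattice `Γ_N` as a
subgroup of this group with `1` isolated, the real test function (TYPING-CENSUS T7); nothing about (N) or (P).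
Sorry-free; axioms: propext / Classical.choice / Quot.sound. §8(d): uses an L-value-free non-vanishing device: NO.
-/

namespace Summit.Ventures.HodgeRepro2.Tier7.Line3.DiscreteUnitaryFactor

open Matrix Summit.Ventures.HodgeRepro2.Tier7.Line3.HyperbolicSize
  Summit.Ventures.HodgeRepro2.Tier7.Line3.DiscreteProductCount
  Summit.Ventures.HodgeRepro2.Tier7.Line3.DiscreteCompactFactor
open scoped MatrixGroups

noncomputable section

/-! ## 1. `U(2)` is compact -/

/-- the unitary `2 × 2` matrices as a set of matrices -/
def unitarySet : Set (Matrix (Fin 2) (Fin 2) ℂ) := {A | star A * A = 1 ∧ A * star A = 1}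

/-- the unitary set is closed -/
theorem isClosed_unitarySet : IsClosed unitarySet := by
  have h1 : IsClosed {A : Matrix (Fin 2) (Fin 2) ℂ | star A * A = 1} :=
    isClosed_eq (continuous_star.matrix_mul continuous_id) continuous_const
  have h2 : IsClosed {A : Matrix (Fin 2) (Fin 2) ℂ | A * star A = 1} :=
    isClosed_eq (continuous_id.matrix_mul continuous_star) continuous_const
  exact h1.inter h2

/-- the columns of a unitary matrix are unit vectors: every entry has norm `≤ 1` -/
theorem norm_entry_le_one {A : Matrix (Fin 2) (Fin 2) ℂ} (hA : star A * A = 1) (i j : Fin 2) : ‖A i j‖ ≤ 1 := by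
  have h := congrFun (congrFun hA j) j
  rw [Matrix.mul_apply, Fin.sum_univ_two, Matrix.one_apply_eq] at h
  simp only [Matrix.star_apply] at h
  -- `conj (A 0 j) * A 0 j + conj (A 1 j) * A 1 j = 1`
  have h0 : star (A 0 j) * A 0 j = ((‖A 0 j‖ ^ 2 : ℝ) : ℂ) := by
    rw [Complex.star_def, Complex.conj_mul']; push_cast; ring
  have h1 : star (A 1 j) * A 1 j = ((‖A 1 j‖ ^ 2 : ℝ) : ℂ) := by
    rw [Complex.star_def, Complex.conj_mul']; push_cast; ring
  rw [h0, h1] at h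
  have hre : ‖A 0 j‖ ^ 2 + ‖A 1 j‖ ^ 2 = 1 := by
    have := congrArg Complex.re h
    simp only [Complex.add_re, Complex.ofReal_re, Complex.one_re] at this
    exact this
  have hsq : ‖A i j‖ ^ 2 ≤ 1 := by
    fin_cases i
    · simp only [Fin.zero_eta]; nlinarith [sq_nonneg ‖A 1 j‖]
    · simp only [Fin.mk_one]; nlinarith [sq_nonneg ‖A 0 j‖]
  nlinarith [norm_nonneg (A i j)]

/-- the compact box of matrices with all entries of norm `≤ 1` -/
def normBox : Set (Matrix (Fin 2) (Fin 2) ℂ) :=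
  Set.univ.pi fun _ => Set.univ.pi fun _ => Metric.closedBall (0 : ℂ) 1

/-- the box is compact -/
theorem isCompact_normBox : IsCompact normBox :=
  isCompact_univ_pi fun _ => isCompact_univ_pi fun _ => isCompact_closedBall 0 1

/-- the unitary set lies in the box -/
theorem unitarySet_subset_normBox : unitarySet ⊆ normBox := by
  intro A hA i _ j _
  rw [mem_closedBall_zero_iff]
  exact norm_entry_le_one hA.1 i j

/-- the unitary set is compact -/
theorem isCompact_unitarySet : IsCompact unitarySet :=
  isCompact_normBox.of_isClosed_subset isClosed_unitarySet unitarySet_subset_normBox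

/-- membership in `Matrix.unitaryGroup` is membership in `unitarySet` -/
theorem mem_unitaryGroup_iff (A : Matrix (Fin 2) (Fin 2) ℂ) : A ∈ Matrix.unitaryGroup (Fin 2) ℂ ↔ A ∈ unitarySet := by
  constructor
  · intro h
    exact ⟨Matrix.mem_unitaryGroup_iff'.mp h, Matrix.mem_unitaryGroup_iff.mp h⟩
  · intro h
    exact Matrix.mem_unitaryGroup_iff.mpr h.2

/-- **`U(2)` IS COMPACT** -/
theorem compactSpace_unitaryGroup : CompactSpace (Matrix.unitaryGroup (Fin 2) ℂ) := by
  have hset : ((Matrix.unitaryGroup (Fin 2) ℂ : Submonoid (Matrix (Fin 2) (Fin 2) ℂ)) :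
      Set (Matrix (Fin 2) (Fin 2) ℂ)) = unitarySet := by
    ext A
    exact mem_unitaryGroup_iff A
  have hc : IsCompact ((Matrix.unitaryGroup (Fin 2) ℂ : Submonoid (Matrix (Fin 2) (Fin 2) ℂ)) :
      Set (Matrix (Fin 2) (Fin 2) ℂ)) := by
    rw [hset]
    exact isCompact_unitarySet
  exact isCompact_iff_compactSpace.mp hc

/-! ## 2. The archimedean model group `U(2) × SL(2,ℝ)²` -/

/-- the archimedean model group: the compact place `U(2)` and the two `(1,1)`-places -/
abbrev U2 := Matrix.unitaryGroup (Fin 2) ℂ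

/-- **THE COUNT OF A DISCRETE SUBGROUP OF `U(2) × SL(2,ℝ)²`** in the product size of the `(1,1)`-factors, `β = 1 + ε'` -/
theorem count_U2_product (Γ : Subgroup (U2 × G₂)) (h : IsolatedOneTop Γ) {ε' : ℝ} (hε' : 0 < ε') :
    ∃ C' : ℝ, ∀ R : ℝ, 0 ≤ R → ∃ t : Finset Γ,
      (∀ γ : Γ, psize (γ : U2 × G₂).2 ≤ R → γ ∈ t) ∧ (t.card : ℝ) ≤ C' * (1 + R) ^ (1 + ε') := by
  haveI := compactSpace_unitaryGroup
  exact count_compact_product Γ h hε'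

/-- **THE LINE'S ARCHIMEDEAN KERNEL ON `U(2) × SL(2,ℝ)²`**: for a subgroup `Γ ≤ U(2) × SL(2,ℝ)²` with `1` isolated,
`f₁` bounded continuous on `U(2)`, `f₂, f₃` continuous with `‖f_j g‖ ≤ C_j (1 + κ g)^(−α)`, `α > 1` (weight `3`:
`α = 3/2`), the Poincaré series `Σ_{γ ∈ Γ} (f₁ f₂ f₃)(x⁻¹ γ y)` is continuous on `(U(2) × SL(2,ℝ)²)²`. -/
theorem continuous_kernelSum_U2_product_three (Γ : Subgroup (U2 × G₂)) (h : IsolatedOneTop Γ)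
    {f₁ : U2 → ℂ} {f₂ f₃ : SL(2, ℝ) → ℂ} (hc₁ : Continuous f₁) (hc₂ : Continuous f₂) (hc₃ : Continuous f₃)
    {C₁ C₂ C₃ α : ℝ} (hα : 1 < α) (h₁ : ∀ k, ‖f₁ k‖ ≤ C₁) (h₂ : ∀ g, ‖f₂ g‖ ≤ C₂ * (1 + κ g) ^ (-α))
    (h₃ : ∀ g, ‖f₃ g‖ ≤ C₃ * (1 + κ g) ^ (-α)) :
    Continuous (fun p : (U2 × G₂) × (U2 × G₂) => PoincareKernel.kernelSum (fun γ : Γ => (γ : U2 × G₂))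
      (fun g : U2 × G₂ => f₁ g.1 * (f₂ g.2.1 * f₃ g.2.2)) p.1 p.2) := by
  haveI := compactSpace_unitaryGroup
  exact continuous_kernelSum_compact_product_three Γ h hc₁ hc₂ hc₃ hα h₁ h₂ h₃

/-- a continuous function on the compact `U(2)` is bounded -/
theorem exists_bound_of_continuous {f₁ : U2 → ℂ} (hc₁ : Continuous f₁) : ∃ C₁ : ℝ, ∀ k, ‖f₁ k‖ ≤ C₁ := by
  haveI := compactSpace_unitaryGroup
  obtain ⟨C₁, hC₁⟩ := (isCompact_range hc₁.norm).bddAbove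
  exact ⟨C₁, fun k => hC₁ (Set.mem_range_self k)⟩

/-! ## 3. The centres of the two `U(1,1)` join the compact factor: `K = U(2) × U(1) × U(1)` -/

/-- the compact factor with the two centres: `U(2) × U(1) × U(1)` (`Circle` = Mathlib's unit circle `U(1)`) -/
abbrev K₃ := U2 × Circle × Circle

/-- `U(2) × U(1) × U(1)` is compact -/
theorem compactSpace_K₃ : CompactSpace K₃ := by
  haveI := compactSpace_unitaryGroup
  infer_instance

/-- **THE LINE'S ARCHIMEDEAN KERNEL WITH THE CENTRES IN THE COMPACT FACTOR**: for a subgroup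
`Γ̃ ≤ (U(2) × U(1) × U(1)) × SL(2,ℝ)²` with `1` isolated (the lift of the real lattice through the 2-to-1 covers
`U(1) × SU(1,1) → U(1,1)` at the two `(1,1)`-places, in words), `f₁` bounded continuous on `U(2) × U(1) × U(1)` (the compact
place together with the two central characters) and `f₂, f₃` with the decay `(1 + κ)^(−α)`, `α > 1`, the Poincaré series is
continuous on `((U(2) × U(1)²) × SL(2,ℝ)²)²`. -/
theorem continuous_kernelSum_K₃_product_three (Γ : Subgroup (K₃ × G₂)) (h : IsolatedOneTop Γ)
    {f₁ : K₃ → ℂ} {f₂ f₃ : SL(2, ℝ) → ℂ} (hc₁ : Continuous f₁) (hc₂ : Continuous f₂) (hc₃ : Continuous f₃)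
    {C₁ C₂ C₃ α : ℝ} (hα : 1 < α) (h₁ : ∀ k, ‖f₁ k‖ ≤ C₁) (h₂ : ∀ g, ‖f₂ g‖ ≤ C₂ * (1 + κ g) ^ (-α))
    (h₃ : ∀ g, ‖f₃ g‖ ≤ C₃ * (1 + κ g) ^ (-α)) :
    Continuous (fun p : (K₃ × G₂) × (K₃ × G₂) => PoincareKernel.kernelSum (fun γ : Γ => (γ : K₃ × G₂))
      (fun g : K₃ × G₂ => f₁ g.1 * (f₂ g.2.1 * f₃ g.2.2)) p.1 p.2) := by
  haveI := compactSpace_K₃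
  exact continuous_kernelSum_compact_product_three Γ h hc₁ hc₂ hc₃ hα h₁ h₂ h₃

/-- the count on `(U(2) × U(1) × U(1)) × SL(2,ℝ)²` in the product size of the `(1,1)`-factors, `β = 1 + ε'` -/
theorem count_K₃_product (Γ : Subgroup (K₃ × G₂)) (h : IsolatedOneTop Γ) {ε' : ℝ} (hε' : 0 < ε') :
    ∃ C' : ℝ, ∀ R : ℝ, 0 ≤ R → ∃ t : Finset Γ,
      (∀ γ : Γ, psize (γ : K₃ × G₂).2 ≤ R → γ ∈ t) ∧ (t.card : ℝ) ≤ C' * (1 + R) ^ (1 + ε') := by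
  haveI := compactSpace_K₃
  exact count_compact_product Γ h hε'

end

end Summit.Ventures.HodgeRepro2.Tier7.Line3.DiscreteUnitaryFactor
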